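import Summits.HubbardSuperconductivity.HubbardSuperconductivity.Theorems.KLProgrammeKLRegimeScaleZeroCovarianceMomentumJets
import Literature.Analysis.FunctionSpaces.TorusSpaceTime

/-!
# Route `KLProgramme`, crux K3 — engine-flow child (stmt-HubbardSuperconductivity-20437), stub (C) at `n = 0`, located item #22a «(C)-SCALE0-PT2»,
# §2a/§2c: the infinite-lattice kernel `a_ω(z)` as a function of the FREQUENCY — smooth, with jets `O(m(ω)^{-n-1})`, off site `O(m(ω)^{-2})`:
# the hypotheses of `fermionicMatsubaraSum_eq_tsum_images` (D3) and of `FermionicPoissonSummationDecay` (D4), discharged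

Cell gate-hubbard-kl, seat p1 g20.  SPEC v2 §2a reduces every off-site row to the object `C_β(x̃,τ) = (1/β)Σ_n e^{-iω_nτ} G̃(ω_n, x̃)` with
`G̃(ω, x̃) = a_ω(x̃) := mFourierCoeff (Torus.descend g_ω) (−x̃)`, `g_ω(y) = uvSymbolFn c Λ (frameLevel μ K (2π•y)) ω` the spatial symbol of
`…ScaleZeroCovarianceTorusPeriodisation`; §2c then applies the antiperiodic Poisson identity `Literature.Analysis.Fourier.fermionicMatsubaraSum_eq_tsum_images`
and the far-image tail of `…FermionicPoissonSummationDecay` to `G := ω ↦ a_ω(x̃)`.  Their hypotheses are: `G ∈ C²(ℝ)`, `G, G′, G″` integrable, and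
`G = O(|ω|^{-b})` for some `b > 1`.  This file proves them (no definition is introduced):

* §1 (generic, scalar space–time fields on `T^d`) `isSmoothSpaceTimeOn_mFourier_smul`, **`hasDerivAt_mFourierCoeff_of_isSmoothSpaceTimeOn`**
  (`d/ds 𝓕(Φ s)(k) = 𝓕(∂ₛΦ s)(k)`, `Torus.IsSmoothSpaceTimeOn.hasDerivWithinAt_integral`), `iterate_timeDerivWithin_univ_apply`,
  `isSmoothSpaceTimeOn_iterate_timeDerivWithin_univ`, `iteratedDeriv_mFourierCoeff_of_isSmoothSpaceTimeOn`, **`contDiff_mFourierCoeff_of_isSmoothSpaceTimeOn`**,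
  `norm_iteratedDeriv_mFourierCoeff_le`;
* §2 (the UV symbol in the frequency) `norm_iteratedDeriv_comp_fbPt_le` (restriction of the joint jets to the frequency line),
  **`norm_iteratedDeriv_uvSymbolFn_freq_le`** — `‖∂_ωⁿ Ψ(ω, e)‖ ≤ c·B·(n+1)!·(2/m(ω))^{n+1}` (`HubbardUVSymbolJoint.norm_iteratedFDeriv_uvSymbol₂_le`);
* §3 (the kernel) `isSmoothSpaceTimeOn_uvSpatialSymbol_descend` — `(ω, y) ↦ g_ω(y)` is a smooth space–time field on `ℝ × T²`;
  **`contDiff_latticeKernel_freq`** — `ω ↦ a_ω(z)` is `C^∞`; **`norm_iteratedDeriv_latticeKernel_freq_le`** — `‖∂_ωⁿ a_ω(z)‖ ≤ c·B·(n+1)!·(2/m(ω))^{n+1}`;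
  **`norm_latticeKernel_freq_le_of_ne_zero`** — OFF SITE `‖a_ω(z)‖ ≤ 16·c·B·D_K/m(ω)²·(1+‖z‖)⁻¹` (`z ≠ 0`; `…MomentumJets` §6 at order one +
  `norm_mFourierCoeff_descend_le_inv_pow_of_ne_zero`);
* §4 (integrability and decay) `integrable_one_div_max_abs_pow`, `integrable_iteratedDeriv_latticeKernel_freq_of_one_le` (every `z`, `n ≥ 1`),
  `integrable_latticeKernel_freq_of_ne_zero`, **`latticeKernel_freq_isBigO_of_ne_zero`** (`= O(|ω|^{-2})` at `cocompact ℝ`), and the package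
  **`latticeKernel_freq_poissonHyps_of_ne_zero`** — `C²`, `G, G′, G″` integrable, `O(|ω|^{-2})`: exactly the hypothesis list of D3/D4 for `G = a_·(z)`,
  every off-site `z`, every frame `K` (first band jet `‖D¹e_K‖ ≤ D_K`) and cutoff table `B` up to order `2`.

Proofs only; no definitions; nothing here asserts (C), any stub of 20437, K3 or superconductivity.  References: BGM 2006 §2.1 (2.3)–(2.4), (2.36aa)
[cite: BenfattoGiulianiMastropietro2006]; Grafakos 2014 §3.1.1, Prop. 3.2.6 [cite: Grafakos2014].
-/

noncomputable section

namespace Summit.HubbardSuperconductivity.HubbardSuperconductivity.Theorems.KLRegimeSplit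

set_option linter.dupNamespace false -- summit = problem name (single-conjunct summit), D-0017

open Literature.MathematicalPhysics.QuantumLattice Literature.Probability.LatticeModels Literature.Analysis.FunctionSpaces
open Summit.HubbardSuperconductivity.HubbardSuperconductivity.Theorems.DispersionFlow
open Summit.HubbardSuperconductivity.HubbardSuperconductivity.Theorems.EngineV8 (contDiff_frameLevel)
open MeasureTheory Set Filter Asymptotics Complex UnitAddTorus Real Torus
open scoped ContDiff Nat Topology

/-! ## §1 Scalar space–time fields on the torus: Fourier coefficients are smooth in the parameter -/

section Generic

variable {d : Type*} [Fintype d]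

/-- Multiplying a smooth space–time field by a character keeps it smooth. -/
theorem isSmoothSpaceTimeOn_mFourier_smul {Φ : ℝ → UnitAddTorus d → ℂ} (hΦ : IsSmoothSpaceTimeOn univ Φ) (k : d → ℤ) :
    IsSmoothSpaceTimeOn univ (fun s y => mFourier (-k) y • Φ s y) := by
  have h := hΦ
  rw [IsSmoothSpaceTimeOn, univ_prod_univ, contDiffOn_univ] at h ⊢
  have hχ : ContDiff ℝ ∞ (fun y : EuclideanSpace ℝ d => mFourier (-k) (proj y)) := isSmooth_mFourier (-k)
  exact (hχ.comp contDiff_snd).smul h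

/-- **Parameter derivative of a Fourier coefficient** (scalar field): for `Φ` smooth on `ℝ × T^d`,
`d/ds 𝓕(Φ s)(k) = 𝓕(∂ₛΦ s)(k)` at every `s` (differentiation under `∫_{T^d}`, `IsSmoothSpaceTimeOn.hasDerivWithinAt_integral`). -/
theorem hasDerivAt_mFourierCoeff_of_isSmoothSpaceTimeOn {Φ : ℝ → UnitAddTorus d → ℂ} (hΦ : IsSmoothSpaceTimeOn univ Φ) (k : d → ℤ) (t : ℝ) :
    HasDerivAt (fun s => mFourierCoeff (Φ s) k) (mFourierCoeff (timeDerivWithin univ Φ t) k) t := by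
  set Ψf : ℝ → UnitAddTorus d → ℂ := fun s y => mFourier (-k) y • Φ s y with hΨf
  have hΨ : IsSmoothSpaceTimeOn univ Ψf := isSmoothSpaceTimeOn_mFourier_smul hΦ k
  have hder := hΨ.hasDerivWithinAt_integral convex_univ (mem_univ t)
  have hfun : (fun s => ∫ y, Ψf s y) = fun s => mFourierCoeff (Φ s) k := by
    funext s; rw [Torus.mFourierCoeff_eq_integral_volume]
  have hpt : ∀ y, timeDerivWithin univ Ψf t y = mFourier (-k) y • timeDerivWithin univ Φ t y := by
    intro y
    simp only [Torus.timeDerivWithin, hΨf]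
    exact ((hΦ.hasDerivWithinAt_slice (mem_univ t) y).const_smul (mFourier (-k) y)).derivWithin
      (uniqueDiffWithinAt_univ)
  have hint : ∫ y, timeDerivWithin univ Ψf t y = mFourierCoeff (timeDerivWithin univ Φ t) k := by
    rw [Torus.mFourierCoeff_eq_integral_volume]
    exact integral_congr_ae (ae_of_all _ hpt)
  rw [hfun, hint] at hder
  exact hder.hasDerivAt univ_mem

omit [Fintype d] in
/-- Iterated one-sided time derivatives on `univ` are iterated derivatives of the slices:
`((∂ₜ)ⁿ Φ) t x = iteratedDeriv n (s ↦ Φ s x) t`. -/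
theorem iterate_timeDerivWithin_univ_apply {F' : Type*} [NormedAddCommGroup F'] [NormedSpace ℝ F'] (Φ : ℝ → UnitAddTorus d → F') (n : ℕ)
    (t : ℝ) (x : UnitAddTorus d) : ((timeDerivWithin univ)^[n] Φ) t x = iteratedDeriv n (fun s => Φ s x) t := by
  induction n generalizing t with
  | zero => simp
  | succ n ih =>
    rw [Function.iterate_succ_apply', iteratedDeriv_succ]
    simp only [Torus.timeDerivWithin, derivWithin_univ]
    congr 1
    funext s
    exact ih s

/-- Iterated time derivatives of a smooth space–time field are smooth space–time fields. -/
theorem isSmoothSpaceTimeOn_iterate_timeDerivWithin_univ {F' : Type*} [NormedAddCommGroup F'] [NormedSpace ℝ F']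
    {Φ : ℝ → UnitAddTorus d → F'} (hΦ : IsSmoothSpaceTimeOn univ Φ) (n : ℕ) :
    IsSmoothSpaceTimeOn univ ((timeDerivWithin univ)^[n] Φ) := by
  induction n with
  | zero => exact hΦ
  | succ n ih =>
    rw [Function.iterate_succ_apply']
    exact ih.timeDerivWithin uniqueDiffOn_univ

/-- `iteratedDeriv n (s ↦ 𝓕(Φ s)(k)) = s ↦ 𝓕((∂ₜ)ⁿΦ s)(k)`. -/
theorem iteratedDeriv_mFourierCoeff_of_isSmoothSpaceTimeOn {Φ : ℝ → UnitAddTorus d → ℂ} (hΦ : IsSmoothSpaceTimeOn univ Φ) (k : d → ℤ)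
    (n : ℕ) : iteratedDeriv n (fun s => mFourierCoeff (Φ s) k) = fun s => mFourierCoeff (((timeDerivWithin univ)^[n] Φ) s) k := by
  induction n with
  | zero => simp
  | succ n ih =>
    rw [iteratedDeriv_succ, ih]
    funext t
    rw [Function.iterate_succ_apply']
    exact (hasDerivAt_mFourierCoeff_of_isSmoothSpaceTimeOn (isSmoothSpaceTimeOn_iterate_timeDerivWithin_univ hΦ n) k t).deriv

/-- **Fourier coefficients of a smooth space–time field are `C^∞` in the parameter.** -/
theorem contDiff_mFourierCoeff_of_isSmoothSpaceTimeOn {Φ : ℝ → UnitAddTorus d → ℂ} (hΦ : IsSmoothSpaceTimeOn univ Φ) (k : d → ℤ) :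
    ContDiff ℝ ∞ (fun s => mFourierCoeff (Φ s) k) := by
  refine contDiff_of_differentiable_iteratedDeriv fun n _ => ?_
  rw [iteratedDeriv_mFourierCoeff_of_isSmoothSpaceTimeOn hΦ k n]
  exact fun t => (hasDerivAt_mFourierCoeff_of_isSmoothSpaceTimeOn (isSmoothSpaceTimeOn_iterate_timeDerivWithin_univ hΦ n) k t).differentiableAt

/-- **Sup bound for the parameter jets of a Fourier coefficient**: `‖∂ₛⁿ 𝓕(Φ s)(k)‖ ≤ C` whenever `‖∂ₛⁿ Φ(s, x)‖ ≤ C` for all `x` (`T^d` has mass one). -/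
theorem norm_iteratedDeriv_mFourierCoeff_le {Φ : ℝ → UnitAddTorus d → ℂ} (hΦ : IsSmoothSpaceTimeOn univ Φ) (k : d → ℤ) (n : ℕ) (t : ℝ) {C : ℝ}
    (hC : ∀ x, ‖iteratedDeriv n (fun s => Φ s x) t‖ ≤ C) : ‖iteratedDeriv n (fun s => mFourierCoeff (Φ s) k) t‖ ≤ C := by
  rw [iteratedDeriv_mFourierCoeff_of_isSmoothSpaceTimeOn hΦ k n]
  show ‖mFourierCoeff (((timeDerivWithin univ)^[n] Φ) t) k‖ ≤ C
  exact Torus.norm_mFourierCoeff_le_of_forall_norm_le (fun x => by rw [iterate_timeDerivWithin_univ_apply]; exact hC x) k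

end Generic

/-! ## §2 The UV symbol as a function of the frequency: jets `‖∂_ωⁿΨ(ω,e)‖ ≤ c·B·(n+1)!·(2/m(ω))^{n+1}` -/

/-- **Restriction of the joint jets to the frequency line**: for `h : FreqBand → ℂ` of class `Cⁿ`,
`‖iteratedDeriv n (ω ↦ h(ω, e)) ω‖ ≤ ‖Dⁿh(ω, e)‖` (the line `ω ↦ (ω, e) = ω•e₀ + e•e₁` is an affine isometry). -/
theorem norm_iteratedDeriv_comp_fbPt_le {h : FreqBand → ℂ} {n : ℕ} (hh : ContDiff ℝ n h) (e om : ℝ) :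
    ‖iteratedDeriv n (fun om : ℝ => h (fbPt om e)) om‖ ≤ ‖iteratedFDeriv ℝ n h (fbPt om e)‖ := by
  set Lm : ℝ →L[ℝ] FreqBand := (1 : ℝ →L[ℝ] ℝ).smulRight fbE0 with hLm
  have hLm_apply : ∀ om : ℝ, Lm om = om • fbE0 := fun om => by simp [hLm]
  have hLm_norm : ‖Lm‖ ≤ 1 := by
    rw [hLm, ContinuousLinearMap.norm_smulRight_apply, norm_fbE0, mul_one]
    exact ContinuousLinearMap.norm_id_le.trans_eq' rfl |>.trans le_rfl
  set g : FreqBand → ℂ := fun v => h (v + e • fbE1) with hg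
  have hgc : ContDiff ℝ n g := hh.comp (contDiff_id.add contDiff_const)
  have hcomp : (fun om : ℝ => h (fbPt om e)) = g ∘ Lm := by
    funext om; simp [hg, hLm_apply, fbPt]
  rw [← norm_iteratedFDeriv_eq_norm_iteratedDeriv, hcomp, ContinuousLinearMap.iteratedFDeriv_comp_right Lm hgc om le_rfl]
  refine (ContinuousMultilinearMap.norm_compContinuousLinearMap_le _ _).trans ?_
  rw [Finset.prod_const, Finset.card_univ, Fintype.card_fin]
  have h1 : ‖iteratedFDeriv ℝ n g (Lm om)‖ = ‖iteratedFDeriv ℝ n h (fbPt om e)‖ := by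
    rw [hg, iteratedFDeriv_comp_add_right, hLm_apply]
    rfl
  rw [h1]
  calc ‖iteratedFDeriv ℝ n h (fbPt om e)‖ * ‖Lm‖ ^ n ≤ ‖iteratedFDeriv ℝ n h (fbPt om e)‖ * 1 ^ n := by
        gcongr
    _ = ‖iteratedFDeriv ℝ n h (fbPt om e)‖ := by rw [one_pow, mul_one]

/-- **Frequency jets of the UV symbol**: if `|χ₂^{(i)}| ≤ B` (`i ≤ n`, `1 ≤ B`), `0 ≤ c`, `0 < Λ`, then for every band value `e` and every real `ω`
`‖∂_ωⁿ Ψ(ω, e)‖ ≤ c·B·(n+1)!·(2/m(ω))^{n+1}`, `m(ω) = max(|ω|, Λ/2)` (`HubbardUVSymbolJoint.norm_iteratedFDeriv_uvSymbol₂_le` on the frequency line). -/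
theorem norm_iteratedDeriv_uvSymbolFn_freq_le {c Λ : ℝ} (hc : 0 ≤ c) (hΛ : 0 < Λ) {n : ℕ} {B : ℝ} (hB1 : 1 ≤ B)
    (hB : ∀ i ≤ n, ∀ t, ‖iteratedDeriv i salmhoferCutoff t‖ ≤ B) (e om : ℝ) :
    ‖iteratedDeriv n (fun om : ℝ => uvSymbolFn c Λ e om) om‖ ≤ c * B * (n + 1) ! * (2 / max |om| (Λ / 2)) ^ (n + 1) := by
  have hfun : (fun om : ℝ => uvSymbolFn c Λ e om) = fun om : ℝ => uvSymbol₂ c Λ (fbPt om e) := by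
    funext om; rw [uvSymbol₂_fbPt]
  rw [hfun]
  refine (norm_iteratedDeriv_comp_fbPt_le (contDiff_uvSymbol₂ c hΛ (n := (n : ℕ∞))) e om).trans ?_
  have h := norm_iteratedFDeriv_uvSymbol₂_le hc hΛ hB1 hB le_rfl (fbPt om e)
  rwa [fbPt_apply_zero] at h

/-! ## §3 The infinite-lattice kernel `a_ω(z) = mFourierCoeff (descend g_ω) (−z)` as a function of `ω` -/

variable {L : ℕ} [NeZero L]

/-- **Smoothness of the spatial symbol in the momentum for EVERY frequency** (also `ω = 0`: the joint symbol `uvSymbol₂` is smooth on the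
whole plane; `…TorusPeriodisation.uvSpatialSymbol_contDiff` asked `ω ≠ 0`). -/
theorem uvSpatialSymbol_contDiff_all (c : ℝ) {Λ : ℝ} (hΛ : 0 < Λ) (μ : ℝ) (K : TrigPolyC4v) (om : ℝ) :
    ContDiff ℝ (⊤ : ℕ∞) (fun y : Momentum => uvSymbolFn c Λ (frameLevel μ K ((2 * π) • y)) om) := by
  have h1 : (fun y : Momentum => uvSymbolFn c Λ (frameLevel μ K ((2 * π) • y)) om) =
      fun y : Momentum => uvSymbol₂ c Λ (fbPt om (frameLevel μ K ((2 * π) • y))) := by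
    funext y; rw [uvSymbol₂_fbPt]
  rw [h1]
  exact (contDiff_uvSymbol₂ c hΛ).comp (contDiff_fbPt_comp ((contDiff_frameLevel μ K).comp (contDiff_const_smul _)) om)

/-- **The spatial symbol is a smooth space–time field on `ℝ × T²`** (parameter = the frequency): the lift of
`ω ↦ descend g_ω` is `(ω, y) ↦ Ψ(ω, e_K(2πy)) = uvSymbol₂ c Λ (ω•e₀ + e_K(2πy)•e₁)`, a composition of smooth maps. -/
theorem isSmoothSpaceTimeOn_uvSpatialSymbol_descend (c : ℝ) {Λ : ℝ} (hΛ : 0 < Λ) (μ : ℝ) (K : TrigPolyC4v) :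
    IsSmoothSpaceTimeOn univ (fun om : ℝ => Torus.descend (fun y : Momentum => uvSymbolFn c Λ (frameLevel μ K ((2 * π) • y)) om)
      (uvSpatialSymbol_isLatticePeriodic c Λ μ K om)) := by
  rw [IsSmoothSpaceTimeOn, univ_prod_univ, contDiffOn_univ]
  have hlift : stLift (fun om : ℝ => Torus.descend (fun y : Momentum => uvSymbolFn c Λ (frameLevel μ K ((2 * π) • y)) om)
      (uvSpatialSymbol_isLatticePeriodic c Λ μ K om)) =
      fun p : ℝ × Momentum => uvSymbol₂ c Λ (fbPt p.1 (frameLevel μ K ((2 * π) • p.2))) := by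
    funext p
    rw [stLift_apply, uvSymbol₂_fbPt]
    exact congrFun (lift_descend_holds _ (uvSpatialSymbol_isLatticePeriodic c Λ μ K p.1)) p.2
  rw [hlift]
  have hu : ContDiff ℝ ∞ (fun y : Momentum => frameLevel μ K ((2 * π) • y)) := (contDiff_frameLevel μ K).comp (contDiff_const_smul _)
  have hinner : ContDiff ℝ ∞ (fun p : ℝ × Momentum => fbPt p.1 (frameLevel μ K ((2 * π) • p.2))) := by
    simp only [fbPt]
    exact (contDiff_fst.smul contDiff_const).add ((hu.comp contDiff_snd).smul contDiff_const)
  exact (contDiff_uvSymbol₂ c hΛ).comp hinner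

/-- **`ω ↦ a_ω(z)` is `C^∞`** for every site `z` and every frame. -/
theorem contDiff_latticeKernel_freq (c : ℝ) {Λ : ℝ} (hΛ : 0 < Λ) (μ : ℝ) (K : TrigPolyC4v) (z : Site 2) :
    ContDiff ℝ ∞ (fun om : ℝ => mFourierCoeff (Torus.descend (fun y : Momentum => uvSymbolFn c Λ (frameLevel μ K ((2 * π) • y)) om)
      (uvSpatialSymbol_isLatticePeriodic c Λ μ K om)) z) :=
  contDiff_mFourierCoeff_of_isSmoothSpaceTimeOn (isSmoothSpaceTimeOn_uvSpatialSymbol_descend c hΛ μ K) z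

/-- **Frequency jets of the kernel**: `‖∂_ωⁿ a_ω(z)‖ ≤ c·B·(n+1)!·(2/m(ω))^{n+1}` for every `z`, `n`, `ω` (`0 ≤ c`, `0 < Λ`, table `B` up to `n`). -/
theorem norm_iteratedDeriv_latticeKernel_freq_le {c Λ : ℝ} (hc : 0 ≤ c) (hΛ : 0 < Λ) (μ : ℝ) (K : TrigPolyC4v) (z : Site 2) {n : ℕ} {B : ℝ}
    (hB1 : 1 ≤ B) (hB : ∀ i ≤ n, ∀ t, ‖iteratedDeriv i salmhoferCutoff t‖ ≤ B) (om : ℝ) :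
    ‖iteratedDeriv n (fun om : ℝ => mFourierCoeff (Torus.descend (fun y : Momentum => uvSymbolFn c Λ (frameLevel μ K ((2 * π) • y)) om)
      (uvSpatialSymbol_isLatticePeriodic c Λ μ K om)) z) om‖ ≤ c * B * (n + 1) ! * (2 / max |om| (Λ / 2)) ^ (n + 1) := by
  refine norm_iteratedDeriv_mFourierCoeff_le (isSmoothSpaceTimeOn_uvSpatialSymbol_descend c hΛ μ K) z n om fun x => ?_
  have hslice : (fun s : ℝ => Torus.descend (fun y : Momentum => uvSymbolFn c Λ (frameLevel μ K ((2 * π) • y)) s)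
      (uvSpatialSymbol_isLatticePeriodic c Λ μ K s) x) = fun s : ℝ => uvSymbolFn c Λ (frameLevel μ K ((2 * π) • Torus.repr x)) s := by
    funext s; rw [Torus.descend_apply]
  rw [hslice]
  exact norm_iteratedDeriv_uvSymbolFn_freq_le hc hΛ hB1 hB _ om

/-- **Off site the kernel is `O(1/m(ω)²)`**: for `z ≠ 0`, with band jets `‖D¹ e_K‖ ≤ D_K` and the table `|χ₂|, |χ₂′| ≤ B`,
`‖a_ω(z)‖ ≤ 16·c·B·D_K/m(ω)²·(1+‖z‖)⁻¹` (`…MomentumJets.norm_iteratedFDeriv_uvSpatialSymbol_le_of_one_le` at order one: the VALUE of the symbol —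
its `1/ω` part — never reaches an off-site coefficient). -/
theorem norm_latticeKernel_freq_le_of_ne_zero {c Λ : ℝ} (hc : 0 ≤ c) (hΛ : 0 < Λ) (μ : ℝ) (K : TrigPolyC4v) {B : ℝ} (hB1 : 1 ≤ B)
    (hB : ∀ i ≤ 1, ∀ t, ‖iteratedDeriv i salmhoferCutoff t‖ ≤ B) {DK : ℝ} (hK : ∀ q : Momentum, ‖iteratedFDeriv ℝ 1 (frameLevel μ K) q‖ ≤ DK)
    {z : Site 2} (hz : z ≠ 0) (om : ℝ) :
    ‖mFourierCoeff (Torus.descend (fun y : Momentum => uvSymbolFn c Λ (frameLevel μ K ((2 * π) • y)) om)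
      (uvSpatialSymbol_isLatticePeriodic c Λ μ K om)) z‖ ≤ 16 * c * B * DK / max |om| (Λ / 2) ^ 2 * ((1 + ‖z‖))⁻¹ := by
  have hjet : ∀ y : Momentum, ‖iteratedFDeriv ℝ 1 (fun y : Momentum => uvSymbolFn c Λ (frameLevel μ K ((2 * π) • y)) om) y‖ ≤
      1 ! * (c * B * (1 + 1) ! * (2 / max |om| (Λ / 2)) ^ 2 * (max 1 (2 / max |om| (Λ / 2))) ^ (1 - 1)) * ((2 * π) * DK) ^ 1 :=
    fun y => norm_iteratedFDeriv_uvSpatialSymbol_le_of_one_le hc hΛ μ K om le_rfl hB1 hB (fun i hi1 hi2 q => by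
      obtain rfl : i = 1 := le_antisymm hi2 hi1
      rw [pow_one]; exact hK q) y
  have h := norm_mFourierCoeff_descend_le_inv_pow_of_ne_zero (uvSpatialSymbol_isLatticePeriodic c Λ μ K om)
    (uvSpatialSymbol_contDiff_all c hΛ μ K om) (M := 1) hjet hz
  refine h.trans (le_of_eq ?_)
  simp only [Nat.factorial, Nat.succ_eq_add_one, pow_one, Nat.sub_self, pow_zero, mul_one, Nat.cast_ofNat,
    zero_add, Nat.cast_succ, Nat.reduceAdd]
  field_simp
  ring


/-! ## §4 Integrability of the first jets and decay at infinity: the hypothesis list of D3/D4 for `G = a_·(z)` -/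

/-- `ω ↦ 1/max(|ω|, a)^p` is integrable on `ℝ` for `a > 0` and `p ≥ 2` (dominated by `(1/a)^{p−2}·(2/a²)·(1+(ω/a)²)⁻¹`). -/
theorem integrable_one_div_max_abs_pow {a : ℝ} (ha : 0 < a) {p : ℕ} (hp : 2 ≤ p) :
    Integrable (fun x : ℝ => 1 / max |x| a ^ p) := by
  obtain ⟨q, rfl⟩ : ∃ q, p = q + 2 := ⟨p - 2, by omega⟩
  have hcont : Continuous (fun x : ℝ => 1 / max |x| a ^ (q + 2)) := by
    refine continuous_const.div ((continuous_abs.max continuous_const).pow _) fun x => ?_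
    exact pow_ne_zero _ (lt_max_of_lt_right ha).ne'
  have hdom : Integrable (fun x : ℝ => (1 / a) ^ q * ((2 / a ^ 2) * (1 + (x / a) ^ 2)⁻¹)) :=
    ((integrable_inv_one_add_sq.comp_div ha.ne').const_mul (2 / a ^ 2)).const_mul ((1 / a) ^ q)
  refine hdom.mono' hcont.aestronglyMeasurable (ae_of_all _ fun x => ?_)
  have hm : 0 < max |x| a := lt_max_of_lt_right ha
  rw [Real.norm_of_nonneg (by positivity)]
  have hmax : x ^ 2 + a ^ 2 ≤ 2 * max |x| a ^ 2 := by
    have h1 : x ^ 2 ≤ max |x| a ^ 2 := by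
      rw [← sq_abs x]; exact pow_le_pow_left₀ (abs_nonneg _) (le_max_left _ _) 2
    have h2 : a ^ 2 ≤ max |x| a ^ 2 := pow_le_pow_left₀ ha.le (le_max_right _ _) 2
    linarith
  have hωa : 0 < x ^ 2 + a ^ 2 := by positivity
  calc 1 / max |x| a ^ (q + 2) = 1 / (max |x| a ^ q * max |x| a ^ 2) := by rw [pow_add]
    _ ≤ 1 / (a ^ q * ((x ^ 2 + a ^ 2) / 2)) := by
        apply one_div_le_one_div_of_le (by positivity)
        exact mul_le_mul (pow_le_pow_left₀ ha.le (le_max_right _ _) q) (by linarith) (by positivity) (by positivity)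
    _ = (1 / a) ^ q * ((2 / a ^ 2) * (1 + (x / a) ^ 2)⁻¹) := by
        rw [one_div_pow]
        field_simp
        ring

/-- **The frequency jets of order `n ≥ 1` of the kernel are integrable** (every site `z`): dominated by `c·B·(n+1)!·2^{n+1}/m(ω)^{n+1}`. -/
theorem integrable_iteratedDeriv_latticeKernel_freq_of_one_le {c Λ : ℝ} (hc : 0 ≤ c) (hΛ : 0 < Λ) (μ : ℝ) (K : TrigPolyC4v) (z : Site 2)
    {n : ℕ} (hn1 : 1 ≤ n) {B : ℝ} (hB1 : 1 ≤ B) (hB : ∀ i ≤ n, ∀ t, ‖iteratedDeriv i salmhoferCutoff t‖ ≤ B) :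
    Integrable (iteratedDeriv n (fun om : ℝ => mFourierCoeff (Torus.descend (fun y : Momentum => uvSymbolFn c Λ (frameLevel μ K ((2 * π) • y)) om)
      (uvSpatialSymbol_isLatticePeriodic c Λ μ K om)) z)) := by
  have hcd := contDiff_latticeKernel_freq c hΛ μ K z
  have hcont : Continuous (iteratedDeriv n (fun om : ℝ => mFourierCoeff (Torus.descend
      (fun y : Momentum => uvSymbolFn c Λ (frameLevel μ K ((2 * π) • y)) om) (uvSpatialSymbol_isLatticePeriodic c Λ μ K om)) z)) :=
    hcd.continuous_iteratedDeriv n (by exact_mod_cast le_top)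
  have hdom : Integrable (fun om : ℝ => c * B * (n + 1) ! * 2 ^ (n + 1) * (1 / max |om| (Λ / 2) ^ (n + 1))) :=
    (integrable_one_div_max_abs_pow (half_pos hΛ) (p := n + 1) (by omega)).const_mul _
  refine hdom.mono' hcont.aestronglyMeasurable (ae_of_all _ fun om => ?_)
  refine (norm_iteratedDeriv_latticeKernel_freq_le hc hΛ μ K z hB1 hB om).trans (le_of_eq ?_)
  rw [div_pow]
  ring

/-- **Off site the kernel itself is integrable in the frequency** (`z ≠ 0`): dominated by `16·c·B·D_K/m(ω)²`. -/
theorem integrable_latticeKernel_freq_of_ne_zero {c Λ : ℝ} (hc : 0 ≤ c) (hΛ : 0 < Λ) (μ : ℝ) (K : TrigPolyC4v) {B : ℝ} (hB1 : 1 ≤ B)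
    (hB : ∀ i ≤ 1, ∀ t, ‖iteratedDeriv i salmhoferCutoff t‖ ≤ B) {DK : ℝ} (hK : ∀ q : Momentum, ‖iteratedFDeriv ℝ 1 (frameLevel μ K) q‖ ≤ DK)
    {z : Site 2} (hz : z ≠ 0) :
    Integrable (fun om : ℝ => mFourierCoeff (Torus.descend (fun y : Momentum => uvSymbolFn c Λ (frameLevel μ K ((2 * π) • y)) om)
      (uvSpatialSymbol_isLatticePeriodic c Λ μ K om)) z) := by
  have hcont := (contDiff_latticeKernel_freq c hΛ μ K z).continuous
  have hdom : Integrable (fun om : ℝ => 16 * c * B * DK * ((1 + ‖z‖))⁻¹ * (1 / max |om| (Λ / 2) ^ 2)) :=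
    (integrable_one_div_max_abs_pow (half_pos hΛ) (p := 2) le_rfl).const_mul _
  refine hdom.mono' hcont.aestronglyMeasurable (ae_of_all _ fun om => ?_)
  refine (norm_latticeKernel_freq_le_of_ne_zero hc hΛ μ K hB1 hB hK hz om).trans (le_of_eq ?_)
  ring

/-- **Decay at infinity**: off site (`z ≠ 0`) the kernel is `O(|ω|^{-2})` along `cocompact ℝ` — the exponent `b = 2 > 1` of D3
(`fermionicMatsubaraSum_eq_tsum_images`). -/
theorem latticeKernel_freq_isBigO_of_ne_zero {c Λ : ℝ} (hc : 0 ≤ c) (hΛ : 0 < Λ) (μ : ℝ) (K : TrigPolyC4v) {B : ℝ} (hB1 : 1 ≤ B)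
    (hB : ∀ i ≤ 1, ∀ t, ‖iteratedDeriv i salmhoferCutoff t‖ ≤ B) {DK : ℝ} (hK : ∀ q : Momentum, ‖iteratedFDeriv ℝ 1 (frameLevel μ K) q‖ ≤ DK)
    {z : Site 2} (hz : z ≠ 0) :
    (fun om : ℝ => mFourierCoeff (Torus.descend (fun y : Momentum => uvSymbolFn c Λ (frameLevel μ K ((2 * π) • y)) om)
      (uvSpatialSymbol_isLatticePeriodic c Λ μ K om)) z) =O[cocompact ℝ] fun x : ℝ => |x| ^ (-(2 : ℝ)) := by
  refine Asymptotics.IsBigO.of_bound (16 * c * B * DK * ((1 + ‖z‖))⁻¹) ?_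
  have hev : ∀ᶠ om : ℝ in cocompact ℝ, Λ / 2 ≤ |om| := by
    rw [cocompact_eq_atBot_atTop, Filter.eventually_sup]
    exact ⟨(Filter.eventually_le_atBot (-(Λ / 2))).mono fun x hx => by rw [abs_of_nonpos (by linarith)]; linarith,
      (Filter.eventually_ge_atTop (Λ / 2)).mono fun x hx => by rw [abs_of_nonneg (by linarith)]; exact hx⟩
  filter_upwards [hev] with om hom
  have hpos : 0 < |om| := (half_pos hΛ).trans_le hom
  have hmax : max |om| (Λ / 2) = |om| := max_eq_left hom
  have hrpow : ‖|om| ^ (-(2 : ℝ))‖ = (|om| ^ 2)⁻¹ := by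
    rw [Real.norm_of_nonneg (Real.rpow_nonneg (abs_nonneg _) _), Real.rpow_neg (abs_nonneg _), Real.rpow_two]
  refine (norm_latticeKernel_freq_le_of_ne_zero hc hΛ μ K hB1 hB hK hz om).trans (le_of_eq ?_)
  rw [hrpow, hmax]
  field_simp

/-- **The hypothesis list of D3/D4 for the off-site kernel, in one statement**: for `z ≠ 0`, `0 ≤ c`, `0 < Λ`, the cutoff table up to order `2`
and the first band jet, `G := ω ↦ a_ω(z)` is `C²`, `G, G′, G″` are integrable, and `G = O(|ω|^{-2})` at infinity — so
`Literature.Analysis.Fourier.fermionicMatsubaraSum_eq_tsum_images` (with `summable_images_of_sq_decay` ∘ `norm_fourier_div_two_pi_le`) and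
`norm_fermionicMatsubaraSum_sub_nearestImages_le_of_iteratedDeriv` apply to it verbatim (`b = 2`). -/
theorem latticeKernel_freq_poissonHyps_of_ne_zero {c Λ : ℝ} (hc : 0 ≤ c) (hΛ : 0 < Λ) (μ : ℝ) (K : TrigPolyC4v) {B : ℝ} (hB1 : 1 ≤ B)
    (hB : ∀ i ≤ 2, ∀ t, ‖iteratedDeriv i salmhoferCutoff t‖ ≤ B) {DK : ℝ} (hK : ∀ q : Momentum, ‖iteratedFDeriv ℝ 1 (frameLevel μ K) q‖ ≤ DK)
    {z : Site 2} (hz : z ≠ 0) :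
    ContDiff ℝ 2 (fun om : ℝ => mFourierCoeff (Torus.descend (fun y : Momentum => uvSymbolFn c Λ (frameLevel μ K ((2 * π) • y)) om)
        (uvSpatialSymbol_isLatticePeriodic c Λ μ K om)) z) ∧
      (∀ n : ℕ, n ≤ 2 → Integrable (iteratedDeriv n (fun om : ℝ => mFourierCoeff (Torus.descend
        (fun y : Momentum => uvSymbolFn c Λ (frameLevel μ K ((2 * π) • y)) om) (uvSpatialSymbol_isLatticePeriodic c Λ μ K om)) z))) ∧
      (fun om : ℝ => mFourierCoeff (Torus.descend (fun y : Momentum => uvSymbolFn c Λ (frameLevel μ K ((2 * π) • y)) om)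
        (uvSpatialSymbol_isLatticePeriodic c Λ μ K om)) z) =O[cocompact ℝ] fun x : ℝ => |x| ^ (-(2 : ℝ)) := by
  have hB1' : ∀ i ≤ 1, ∀ t, ‖iteratedDeriv i salmhoferCutoff t‖ ≤ B := fun i hi t => hB i (by omega) t
  refine ⟨(contDiff_latticeKernel_freq c hΛ μ K z).of_le (by norm_cast), fun n hn => ?_,
    latticeKernel_freq_isBigO_of_ne_zero hc hΛ μ K hB1 hB1' hK hz⟩
  rcases Nat.eq_zero_or_pos n with rfl | hn1
  · rw [iteratedDeriv_zero]
    exact integrable_latticeKernel_freq_of_ne_zero hc hΛ μ K hB1 hB1' hK hz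
  · exact integrable_iteratedDeriv_latticeKernel_freq_of_one_le hc hΛ μ K z hn1 hB1 (fun i hi t => hB i (hi.trans hn) t)

end Summit.HubbardSuperconductivity.HubbardSuperconductivity.Theorems.KLRegimeSplit

end
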